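import Literature.AlgebraicTopology.SingularHomology.OrientationReversingHomeomorph
import Literature.Geometry.Manifold.ModelChange
import Literature.Topology.FourManifolds.ConnectedSumSignature
import Mathlib.Analysis.SpecialFunctions.Complex.Circle
import Mathlib.Geometry.Manifold.Instances.Sphere
import HarnessLib

/-!
# The signature of a product with a circle vanishes: `σ(N × S¹) = 0`, `σ(T⁴) = 0`, `σ(F × T²) = 0`

R. C. Kirby, *The Topology of 4-Manifolds* (1989), Ch. II §5, p. 27 (reversing the orientation
reverses the sign of the index) with M. W. Hirsch, *Differential Topology* (1976), Ch. 4 §4,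
pp. 105–106 (the orientation character of a self-map of a connected manifold is decided at one
point; reflections reverse orientation): the reflection `(x, z) ↦ (x, z̄)` of `N × S¹` reverses
every orientation, so **every closed oriented `4`-manifold of the form `N³ × S¹` has signature
zero** — in particular the `4`-torus `T⁴ = T³ × S¹` and `F × T² = (F × S¹) × S¹` for a closed
surface `F`.  These are the two vanishing signatures in the proof of Lemma 8 of A. Akhmedov,
B. D. Park, *Exotic smooth structures on small 4-manifolds with odd signatures*, Invent. Math. 181
(2010), §4 and §9 (arXiv:math/0701829: "`σ(Z') = σ(Z''(1/q, m/r)) = -1`" for the torus-surgered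
`T⁴ # ℂℙ²bar`, i.e. `σ(T⁴ # ℂℙ²bar) = 0 + (-1)`; and `σ(X₁(m)) = σ(Y₁(1,1)) + σ(Z''(1,m)) = 0 + (-1)`
with `Y₁(1,1)` Luttinger-surgered from `Σ₂ × T²`, `σ(Σ₂ × T²) = 0`), up to the invariance of `σ`
under torus surgery and Novikov additivity, which are NOT formalised here.

The product `N × S¹` (Mathlib's product manifold over `ModelProd (𝔼ᵈ) (𝔼¹)`, `S¹ = Circle`) is
recharted on `𝔼ⁿ` along a linear isomorphism `𝔼ᵈ × 𝔼¹ ≃L 𝔼ⁿ`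
(`Literature.Geometry.Manifold.Rechart`, same topology), so that the tree's singular-homology
notions (`HomologicalOrientation`, `signature`) apply.  Contents (all PROVED, no definitions):

* `exists_chart_circle_inv` — a partial homeomorphism `e : S¹ ⇀ 𝔼¹` around `1` in which
  `z ↦ z⁻¹` reads `v ↦ -v` (a symmetric branch of `Circle.exp`, `isLocalHomeomorph_circleExp`);
* **`HomologicalOrientation.comap_prodCircleReflection_eq_neg`** — for `N` connected Hausdorff
  charted on `𝔼ᵈ`, the reflection `ρ = id × (·)⁻¹` of `X = N × S¹` satisfies `μ.comap ρ = -μ` for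
  EVERY `ℤ`-orientation `μ` of `X` (fixed point `(x₀, 1)`; in the chart
  `(chart of N at x₀) × e` the reflection is the linear map `id × (-id)`, `det = -1`;
  `comap_eq_neg_of_hasFDerivAt` of `…OrientationReversingHomeomorph`);
* `signature_intersectionForm_prodCircle_eq_zero`, **`signature_prodCircle_eq_zero`** —
  `σ(N × S¹, μ) = 0` for `N` closed connected (dimension `2k`, resp. `4`);
* `exists_prodCircle_model` — for a closed connected smooth `3`-manifold `N`: a closed connected
  smooth `4`-manifold `X ≃ₜ N × S¹` (charted on `ℝ⁴`, `C^∞`) all of whose `ℤ`-orientations have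
  `σ = 0`; `exists_fourTorus_model` (`T⁴ ≃ₜ S¹ × S¹ × S¹ × S¹`), `exists_surface_prod_torus_model`
  (`F × S¹ × S¹` for a closed connected smooth surface `F`);
* `exists_isConnectedSum_prodCircle_complexProjectivePlane`,
  `exists_isConnectedSum_fourTorus_complexProjectivePlane` — **`σ(T⁴ # ℂℙ²bar) = -1`**: for
  every `ℤ`-orientation `μ` of such an `X` (resp. of `T⁴`) there is a connected sum `X # ℂℙ²`
  (with `ℂℙ²` oppositely oriented) of signature `σ(X, μ) - 1 = -1` and `b₂ = b₂(X) + 1`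
  (`exists_isConnectedSum_complexProjectivePlane_signature_sub_one`, `…ConnectedSumSignature`).
  The orientation of `T⁴` is an INPUT here (its construction is not part of this file).

## References

* R. C. Kirby, *The Topology of 4-Manifolds*, LNM 1374, Springer 1989, Ch. II §5 p. 27. [Kirby1989]
* M. W. Hirsch, *Differential Topology*, GTM 33, Springer 1976, Ch. 4 §4 pp. 105–106. [HirschDT1976]
* A. Akhmedov, B. D. Park, Invent. Math. 181 (2010) 577–603, §4 and §9 (proof of Lemma 8).
  [AkhmedovPark2010]
* R. E. Gompf, A. I. Stipsicz, *4-Manifolds and Kirby Calculus*, AMS 1999, §1.2. [GompfStipsiczGSM1999]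
-/

noncomputable section

open Set Filter Function
open scoped Manifold ContDiff Topology Real
open Literature.AlgebraicTopology.SingularHomology
open Literature.Geometry.Manifold (Rechart)

universe u

namespace Literature.Topology.FourManifolds

/-! ### A chart of the circle at `1` in which inversion is `v ↦ -v` -/

/-- **A symmetric exponential chart of `S¹` at `1`.** There is a partial homeomorphism
`e : S¹ ⇀ 𝔼¹` with `1 ∈ e.source`, `e 1 = 0`, whose target is symmetric and in which the inversion
`z ↦ z⁻¹ = z̄` reads `v ↦ -v`: `e ((e.symm v)⁻¹) = -v` on `e.target` (a branch of the covering map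
`t ↦ exp(it)` on a symmetric interval, `Circle.exp (-t) = (Circle.exp t)⁻¹`, composed with any
linear `ℝ ≃L 𝔼¹`). [folklore] -/
theorem exists_chart_circle_inv (ℓ : ℝ ≃L[ℝ] EuclideanSpace ℝ (Fin 1)) :
    ∃ e : OpenPartialHomeomorph Circle (EuclideanSpace ℝ (Fin 1)),
      (1 : Circle) ∈ e.source ∧ e 1 = 0 ∧
        ∀ v ∈ e.target, -v ∈ e.target ∧ e ((e.symm v)⁻¹) = -v := by
  obtain ⟨e₀, h0, he₀⟩ := isLocalHomeomorph_circleExp 0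
  -- a symmetric open part of the source
  set S : Set ℝ := e₀.source ∩ Neg.neg ⁻¹' e₀.source with hS_def
  have hS : IsOpen S := e₀.open_source.inter (e₀.open_source.preimage continuous_neg)
  have h0S : (0 : ℝ) ∈ e₀.source ∩ S := ⟨h0, h0, by simpa using h0⟩
  set e₁ := e₀.restrOpen S hS with he₁
  have hsrc : e₁.source = e₀.source ∩ S := rfl
  have he₁exp : ∀ t, e₁ t = Circle.exp t := fun t => (congrFun he₀ t).symm
  set e : OpenPartialHomeomorph Circle (EuclideanSpace ℝ (Fin 1)) :=
    e₁.symm.transHomeomorph ℓ.toHomeomorph with he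
  have h1tgt : (1 : Circle) ∈ e₁.target := by
    rw [← Circle.exp_zero, ← he₁exp 0]
    exact e₁.map_source (hsrc ▸ h0S)
  have hsymm1 : e₁.symm 1 = 0 := by
    rw [← Circle.exp_zero, ← he₁exp 0]
    exact e₁.left_inv (hsrc ▸ h0S)
  refine ⟨e, h1tgt, ?_, fun v hv => ?_⟩
  · change ℓ (e₁.symm 1) = 0
    rw [hsymm1, map_zero]
  · -- `v ∈ e.target` means `t := ℓ⁻¹ v ∈ e₁.source = e₀.source ∩ S`
    have hv' : ℓ.symm v ∈ e₀.source ∩ S := hv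
    have hneg : ℓ.symm (-v) ∈ e₀.source ∩ S := by
      rw [map_neg]
      exact ⟨hv'.2.2, hv'.2.2, by simpa using hv'.2.1⟩
    refine ⟨hneg, ?_⟩
    -- `e.symm w = exp (ℓ⁻¹ w)`, so `(e.symm v)⁻¹ = exp (-ℓ⁻¹ v) = e.symm (-v)`
    have hsv : e.symm v = Circle.exp (ℓ.symm v) := he₁exp _
    have hsnv : e.symm (-v) = Circle.exp (-ℓ.symm v) := by
      rw [← map_neg]; exact he₁exp _
    have hinv : (e.symm v)⁻¹ = e.symm (-v) := by rw [hsv, hsnv, Circle.exp_neg]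
    rw [hinv]
    exact e.right_inv hneg

/-! ### The reflection of `N × S¹` reverses every orientation -/

section Reflection

variable {d n : ℕ} {N : Type u} [TopologicalSpace N] [T2Space N] [ConnectedSpace N]
  [ChartedSpace (EuclideanSpace ℝ (Fin d)) N]
  (f : ModelProd (EuclideanSpace ℝ (Fin d)) (EuclideanSpace ℝ (Fin 1)) ≃ₜ EuclideanSpace ℝ (Fin n))
  (L : (EuclideanSpace ℝ (Fin d) × EuclideanSpace ℝ (Fin 1)) ≃L[ℝ] EuclideanSpace ℝ (Fin n))

/-- **The reflection `(x, z) ↦ (x, z⁻¹)` of `N × S¹` reverses every `ℤ`-orientation** (Hirsch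
1976, Ch. 4 §4, pp. 105–106: decided at the fixed point `(x₀, 1)`, where in the product of a chart
of `N` with the symmetric exponential chart of `S¹` the reflection is the linear map `id × (-id)` of
determinant `-1`). Here `N` is a connected Hausdorff space charted on `𝔼ᵈ`, `X = N × S¹` is
recharted on `𝔼ⁿ` along a homeomorphism `f` that is a linear isomorphism `L : 𝔼ᵈ × 𝔼¹ ≃L 𝔼ⁿ`
(`Literature.Geometry.Manifold.Rechart`), and `ρ = out ≫ (id × (·)⁻¹) ≫ into`; the conclusion is
`μ.comap ρ = -μ` for every `ℤ`-orientation `μ` of `X` in dimension `n`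
(`HomologicalOrientation.comap_eq_neg_of_hasFDerivAt`). [cite: HirschDT1976, Ch. 4 §4 pp. 105–106] -/
theorem _root_.Literature.AlgebraicTopology.SingularHomology.HomologicalOrientation.comap_prodCircleReflection_eq_neg
    (hfL : ∀ x, f x = L x) (μ : HomologicalOrientation ℤ (Rechart f (N × Circle)) n) :
    μ.comap (((Rechart.outHomeomorph f (N × Circle)).trans
      ((Homeomorph.refl N).prodCongr (Homeomorph.inv Circle))).trans
        (Rechart.outHomeomorph f (N × Circle)).symm) = -μ := by
  -- notation
  set X : Type u := Rechart f (N × Circle) with hX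
  set eo : X ≃ₜ N × Circle := Rechart.outHomeomorph f (N × Circle) with heo
  set ρ : X ≃ₜ X := (eo.trans ((Homeomorph.refl N).prodCongr (Homeomorph.inv Circle))).trans eo.symm
    with hρ
  haveI : ConnectedSpace X := inferInstanceAs (ConnectedSpace (N × Circle))
  -- the fixed point `y = (x₀, 1)`
  obtain ⟨x₀⟩ : Nonempty N := inferInstance
  set y : X := Rechart.into f (N × Circle) (x₀, 1) with hy
  have hρy : ρ y = y := by
    change Rechart.into f (N × Circle) (x₀, (1 : Circle)⁻¹) = Rechart.into f (N × Circle) (x₀, 1)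
    rw [inv_one]
  -- the chart `(φ × e) ≫ f` at `y`, `φ` the chart of `N` at `x₀`, `e` the symmetric chart of `S¹`
  obtain ⟨ℓ⟩ : Nonempty (ℝ ≃L[ℝ] EuclideanSpace ℝ (Fin 1)) :=
    ⟨ContinuousLinearEquiv.ofFinrankEq (by simp)⟩
  obtain ⟨e, h1e, -, he⟩ := exists_chart_circle_inv ℓ
  set φ := chartAt (EuclideanSpace ℝ (Fin d)) x₀ with hφ
  set c : OpenPartialHomeomorph X (EuclideanSpace ℝ (Fin n)) :=
    eo.transOpenPartialHomeomorph ((φ.prod e).transHomeomorph f) with hc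
  have hyc : y ∈ c.source := by
    change (x₀, (1 : Circle)) ∈ (φ.prod e).source
    rw [OpenPartialHomeomorph.prod_source]
    exact ⟨mem_chart_source _ x₀, h1e⟩
  have hcy : c y = L (φ x₀, e 1) := hfL _
  -- the reflection read in the chart `c`
  have hT : ∀ v, c (ρ (c.symm v)) = f (φ (φ.symm (f.symm v).1), e ((e.symm (f.symm v).2)⁻¹)) :=
    fun v => rfl
  have hfsymm : ∀ v, f.symm v = L.symm v := fun v => by
    rw [Homeomorph.symm_apply_eq, hfL, ContinuousLinearEquiv.apply_symm_apply]
  -- the linear model `A = L ∘ (id × (-id)) ∘ L⁻¹`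
  set R : (EuclideanSpace ℝ (Fin d) × EuclideanSpace ℝ (Fin 1)) →L[ℝ]
      (EuclideanSpace ℝ (Fin d) × EuclideanSpace ℝ (Fin 1)) :=
    (ContinuousLinearMap.id ℝ (EuclideanSpace ℝ (Fin d))).prodMap
      (-ContinuousLinearMap.id ℝ (EuclideanSpace ℝ (Fin 1))) with hR
  set A : EuclideanSpace ℝ (Fin n) →L[ℝ] EuclideanSpace ℝ (Fin n) :=
    (L : (EuclideanSpace ℝ (Fin d) × EuclideanSpace ℝ (Fin 1)) →L[ℝ] EuclideanSpace ℝ (Fin n)).comp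
      (R.comp (L.symm : EuclideanSpace ℝ (Fin n) →L[ℝ]
        (EuclideanSpace ℝ (Fin d) × EuclideanSpace ℝ (Fin 1)))) with hA
  have hAv : ∀ v, A v = L ((L.symm v).1, -(L.symm v).2) := fun v => rfl
  -- `c ∘ ρ ∘ c⁻¹ = A` near `c y`
  have hV : ∀ᶠ v in 𝓝 (c y), (L.symm v).1 ∈ φ.target ∧ (L.symm v).2 ∈ e.target := by
    have hcont : Continuous fun v : EuclideanSpace ℝ (Fin n) => L.symm v := L.symm.continuous
    have hopen : IsOpen ((fun v : EuclideanSpace ℝ (Fin n) => L.symm v) ⁻¹'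
        (φ.target ×ˢ e.target)) := (φ.open_target.prod e.open_target).preimage hcont
    have hmem : c y ∈ (fun v : EuclideanSpace ℝ (Fin n) => L.symm v) ⁻¹' (φ.target ×ˢ e.target) := by
      rw [mem_preimage, hcy, ContinuousLinearEquiv.symm_apply_apply]
      exact ⟨φ.map_source (mem_chart_source _ x₀), e.map_source h1e⟩
    exact hopen.mem_nhds hmem
  have hAT : HasFDerivAt (fun v => c (ρ (c.symm v))) A (c y) := by
    refine A.hasFDerivAt.congr_of_eventuallyEq ?_
    filter_upwards [hV] with v hv
    rw [hT, hfsymm, φ.right_inv hv.1, (he _ hv.2).2, hfL, hAv]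
  -- `det A = det (id × (-id)) = -1`
  have hRdet : LinearMap.det (R : (EuclideanSpace ℝ (Fin d) × EuclideanSpace ℝ (Fin 1)) →ₗ[ℝ]
      (EuclideanSpace ℝ (Fin d) × EuclideanSpace ℝ (Fin 1))) = -1 := by
    have hRR : (R : (EuclideanSpace ℝ (Fin d) × EuclideanSpace ℝ (Fin 1)) →ₗ[ℝ]
        (EuclideanSpace ℝ (Fin d) × EuclideanSpace ℝ (Fin 1))) =
        LinearMap.prodMap LinearMap.id ((-1 : ℝ) • LinearMap.id) := by
      apply LinearMap.ext
      rintro ⟨a, b⟩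
      simp [hR]
    rw [hRR, LinearMap.det_prodMap, LinearMap.det_id, LinearMap.det_smul, LinearMap.det_id,
      finrank_euclideanSpace_fin]
    norm_num
  have hAdet : LinearMap.det (A : EuclideanSpace ℝ (Fin n) →ₗ[ℝ] EuclideanSpace ℝ (Fin n)) = -1 := by
    rw [← hRdet]
    exact LinearMap.det_conj _ L.toLinearEquiv
  exact μ.comap_eq_neg_of_hasFDerivAt ρ hρy c hyc hAT (by rw [hAdet]; norm_num)

end Reflection

/-! ### `σ(N × S¹) = 0` -/

section Signature

variable {d n : ℕ} {N : Type u} [TopologicalSpace N] [T2Space N] [CompactSpace N]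
  [ConnectedSpace N] [ChartedSpace (EuclideanSpace ℝ (Fin d)) N]
  (f : ModelProd (EuclideanSpace ℝ (Fin d)) (EuclideanSpace ℝ (Fin 1)) ≃ₜ EuclideanSpace ℝ (Fin n))
  (L : (EuclideanSpace ℝ (Fin d) × EuclideanSpace ℝ (Fin 1)) ≃L[ℝ] EuclideanSpace ℝ (Fin n))

/-- **`σ(N × S¹) = 0` in dimension `2k`** (Kirby 1989, Ch. II §5, p. 27 with Hirsch 1976, Ch. 4
§4: the reflection in the circle factor reverses the orientation, and reversing the orientation
reverses the sign of the signature). For a closed connected topological manifold `N` charted on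
`𝔼ᵈ`, the product `N × S¹` recharted on `𝔼ⁿ` along a linear isomorphism `𝔼ᵈ × 𝔼¹ ≃L 𝔼ⁿ`, any
`h : k + k = n` and ANY `ℤ`-orientation `μ`: the signature of the intersection form on `Hᵏ/T`
vanishes. [cite: Kirby1989, Ch. II §5 p. 27] -/
theorem signature_intersectionForm_prodCircle_eq_zero (hfL : ∀ x, f x = L x) {k : ℕ}
    (h : k + k = n) (μ : HomologicalOrientation ℤ (Rechart f (N × Circle)) n) :
    (intersectionForm h μ).signature = 0 :=
  signature_intersectionForm_eq_zero_of_comap_eq_neg h μ _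
    (μ.comap_prodCircleReflection_eq_neg f L hfL)

/-- **`σ(N³ × S¹) = 0`** (Kirby 1989, Ch. II §5, p. 27; Hirsch 1976, Ch. 4 §4): for a closed
connected topological `3`-manifold `N` (charted on `ℝ³`; more generally on `𝔼ᵈ` with a linear
isomorphism `𝔼ᵈ × 𝔼¹ ≃L ℝ⁴`), EVERY `ℤ`-orientation `μ` of the closed `4`-manifold `N × S¹`
(recharted on `ℝ⁴`) has `σ(N × S¹, μ) = 0` — the case of the `4`-torus `T³ × S¹` and of
`Σ₂ × T² = (Σ₂ × S¹) × S¹` in Akhmedov–Park 2010, §4 and §9 ("`σ = 0 + (-1)`").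
[cite: Kirby1989, Ch. II §5 p. 27] [cite: AkhmedovPark2010, §9, proof of Lemma 8] -/
theorem signature_prodCircle_eq_zero
    (f : ModelProd (EuclideanSpace ℝ (Fin d)) (EuclideanSpace ℝ (Fin 1)) ≃ₜ EuclideanSpace ℝ (Fin 4))
    (L : (EuclideanSpace ℝ (Fin d) × EuclideanSpace ℝ (Fin 1)) ≃L[ℝ] EuclideanSpace ℝ (Fin 4))
    (hfL : ∀ x, f x = L x) (μ : HomologicalOrientation ℤ (Rechart f (N × Circle)) 4) :
    μ.signature = 0 :=
  μ.signature_eq_zero_of_comap_eq_neg _ (μ.comap_prodCircleReflection_eq_neg f L hfL)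

end Signature

/-! ### Smooth closed `4`-manifolds `N³ × S¹`, `T⁴`, `F × T²` with all signatures zero -/

section Models

/-- **`N³ × S¹` as a closed smooth `4`-manifold of signature zero.** For a closed connected smooth
`3`-manifold `N` (charted on `ℝ³`, `C^∞`), there is a closed connected smooth `4`-manifold `X`,
charted on `ℝ⁴` and `C^∞` for `𝓡 4`, homeomorphic to `N × S¹` — namely Mathlib's product manifold
`N × Circle` recharted along a linear isomorphism `ℝ³ × ℝ¹ ≃L ℝ⁴`
(`Literature.Geometry.Manifold.Rechart`, same topology; Lee 2013, Prop. 1.17) — all of whose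
`ℤ`-orientations have signature `0` (`signature_prodCircle_eq_zero`; Kirby 1989, II §5 p. 27).
[cite: Kirby1989, Ch. II §5 p. 27] -/
theorem exists_prodCircle_model (N : Type u) [TopologicalSpace N] [T2Space N]
    [SecondCountableTopology N] [CompactSpace N] [ConnectedSpace N]
    [ChartedSpace (EuclideanSpace ℝ (Fin 3)) N] [IsManifold (𝓡 3) ∞ N] :
    ∃ (X : Type u) (_ : TopologicalSpace X) (_ : T2Space X) (_ : SecondCountableTopology X)
      (_ : ChartedSpace (EuclideanSpace ℝ (Fin 4)) X) (_ : IsManifold (𝓡 4) ∞ X)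
      (_ : CompactSpace X) (_ : ConnectedSpace X),
      Nonempty (X ≃ₜ N × Circle) ∧ ∀ μ : HomologicalOrientation ℤ X 4, μ.signature = 0 := by
  let L : (EuclideanSpace ℝ (Fin 3) × EuclideanSpace ℝ (Fin 1)) ≃L[ℝ] EuclideanSpace ℝ (Fin 4) :=
    ContinuousLinearEquiv.ofFinrankEq (by simp)
  let f : ModelProd (EuclideanSpace ℝ (Fin 3)) (EuclideanSpace ℝ (Fin 1)) ≃ₜ
      EuclideanSpace ℝ (Fin 4) := L.toHomeomorph
  have hIf : ∀ x, f x = L (((𝓡 3).prod (𝓡 1)) x) := fun x => rfl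
  have hf := Rechart.contMDiff_of_apply_eq_linear (I := (𝓡 3).prod (𝓡 1)) (n := ∞) f L hIf
  have hf' := Rechart.contMDiff_symm_of_apply_eq_linear (I := (𝓡 3).prod (𝓡 1)) (n := ∞) f L hIf
  have hX : IsManifold (𝓡 4) ∞ (Rechart f (N × Circle)) := Rechart.isManifold f _ hf hf'
  haveI : SecondCountableTopology (Rechart f (N × Circle)) :=
    inferInstanceAs (SecondCountableTopology (N × Circle))
  haveI : ConnectedSpace (Rechart f (N × Circle)) := inferInstanceAs (ConnectedSpace (N × Circle))
  exact ⟨Rechart f (N × Circle), inferInstance, inferInstance, inferInstance, inferInstance, hX,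
    inferInstance, inferInstance, ⟨Rechart.outHomeomorph f _⟩,
    fun μ => signature_prodCircle_eq_zero f L (fun _ => rfl) μ⟩

/-- **`F × S¹` recharted: a closed connected smooth surface times a circle is a closed connected
smooth `3`-manifold** homeomorphic to `F × S¹` (Mathlib's product manifold recharted along
`ℝ² × ℝ¹ ≃L ℝ³`; bookkeeping for `exists_surface_prod_torus_model`). [folklore] -/
theorem exists_surface_prod_circle_model (F : Type u) [TopologicalSpace F] [T2Space F]
    [SecondCountableTopology F] [CompactSpace F] [ConnectedSpace F]
    [ChartedSpace (EuclideanSpace ℝ (Fin 2)) F] [IsManifold (𝓡 2) ∞ F] :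
    ∃ (N : Type u) (_ : TopologicalSpace N) (_ : T2Space N) (_ : SecondCountableTopology N)
      (_ : ChartedSpace (EuclideanSpace ℝ (Fin 3)) N) (_ : IsManifold (𝓡 3) ∞ N)
      (_ : CompactSpace N) (_ : ConnectedSpace N), Nonempty (N ≃ₜ F × Circle) := by
  let L : (EuclideanSpace ℝ (Fin 2) × EuclideanSpace ℝ (Fin 1)) ≃L[ℝ] EuclideanSpace ℝ (Fin 3) :=
    ContinuousLinearEquiv.ofFinrankEq (by simp)
  let f : ModelProd (EuclideanSpace ℝ (Fin 2)) (EuclideanSpace ℝ (Fin 1)) ≃ₜ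
      EuclideanSpace ℝ (Fin 3) := L.toHomeomorph
  have hIf : ∀ x, f x = L (((𝓡 2).prod (𝓡 1)) x) := fun x => rfl
  have hf := Rechart.contMDiff_of_apply_eq_linear (I := (𝓡 2).prod (𝓡 1)) (n := ∞) f L hIf
  have hf' := Rechart.contMDiff_symm_of_apply_eq_linear (I := (𝓡 2).prod (𝓡 1)) (n := ∞) f L hIf
  have hN : IsManifold (𝓡 3) ∞ (Rechart f (F × Circle)) := Rechart.isManifold f _ hf hf'
  haveI : SecondCountableTopology (Rechart f (F × Circle)) :=
    inferInstanceAs (SecondCountableTopology (F × Circle))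
  haveI : ConnectedSpace (Rechart f (F × Circle)) := inferInstanceAs (ConnectedSpace (F × Circle))
  exact ⟨Rechart f (F × Circle), inferInstance, inferInstance, inferInstance, inferInstance, hN,
    inferInstance, inferInstance, ⟨Rechart.outHomeomorph f _⟩⟩

/-- **`σ(F × T²) = 0`** (in Akhmedov–Park 2010, §9: `σ(Σ₂ × T²) = 0`, the first summand of
`σ(X₁(m)) = 0 + (-1)`, `Y₁(1,1)` being obtained from `Σ₂ × T²` by Luttinger surgeries). For a closed
connected smooth surface `F` there is a closed connected smooth `4`-manifold `X ≃ₜ (F × S¹) × S¹`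
(charted on `ℝ⁴`, `C^∞`) all of whose `ℤ`-orientations have signature `0`
(`exists_prodCircle_model` applied to `N = F × S¹`). The Luttinger-surgery invariance of `σ` is NOT
formalised here. [cite: AkhmedovPark2010, §9, proof of Lemma 8] [cite: Kirby1989, Ch. II §5 p. 27] -/
theorem exists_surface_prod_torus_model (F : Type u) [TopologicalSpace F] [T2Space F]
    [SecondCountableTopology F] [CompactSpace F] [ConnectedSpace F]
    [ChartedSpace (EuclideanSpace ℝ (Fin 2)) F] [IsManifold (𝓡 2) ∞ F] :
    ∃ (X : Type u) (_ : TopologicalSpace X) (_ : T2Space X) (_ : SecondCountableTopology X)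
      (_ : ChartedSpace (EuclideanSpace ℝ (Fin 4)) X) (_ : IsManifold (𝓡 4) ∞ X)
      (_ : CompactSpace X) (_ : ConnectedSpace X),
      Nonempty (X ≃ₜ (F × Circle) × Circle) ∧ ∀ μ : HomologicalOrientation ℤ X 4, μ.signature = 0 := by
  obtain ⟨N, _, _, _, _, _, _, _, ⟨eN⟩⟩ := exists_surface_prod_circle_model F
  obtain ⟨X, _, _, _, _, _, _, _, ⟨eX⟩, hσ⟩ := exists_prodCircle_model N
  exact ⟨X, inferInstance, inferInstance, inferInstance, inferInstance, inferInstance, inferInstance,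
    inferInstance, ⟨eX.trans (eN.prodCongr (Homeomorph.refl Circle))⟩, hσ⟩

/-- **The `4`-torus `T⁴ = S¹ × S¹ × S¹ × S¹` as a closed smooth `4`-manifold of signature zero**
(in Akhmedov–Park 2010, §4: `σ(T⁴) = 0`, whence `σ(T⁴ # ℂℙ²bar) = 0 + (-1) = -1`): there is a
closed connected smooth `4`-manifold `X` charted on `ℝ⁴`, homeomorphic to
`(S¹ × S¹ × S¹) × S¹` (Mathlib's `Circle`; `S¹ × S¹ × S¹` is the tree's `ThreeTorus`), all of
whose `ℤ`-orientations have signature `0` — `exists_prodCircle_model` for the `3`-torus recharted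
on `ℝ³`. [cite: AkhmedovPark2010, §4 ("σ(Z'') = -1") and §9] [cite: Kirby1989, Ch. II §5 p. 27] -/
theorem exists_fourTorus_model :
    ∃ (X : Type) (_ : TopologicalSpace X) (_ : T2Space X) (_ : SecondCountableTopology X)
      (_ : ChartedSpace (EuclideanSpace ℝ (Fin 4)) X) (_ : IsManifold (𝓡 4) ∞ X)
      (_ : CompactSpace X) (_ : ConnectedSpace X),
      Nonempty (X ≃ₜ (Circle × Circle × Circle) × Circle) ∧
        ∀ μ : HomologicalOrientation ℤ X 4, μ.signature = 0 := by
  let L : (EuclideanSpace ℝ (Fin 1) × (EuclideanSpace ℝ (Fin 1) × EuclideanSpace ℝ (Fin 1))) ≃L[ℝ]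
      EuclideanSpace ℝ (Fin 3) := ContinuousLinearEquiv.ofFinrankEq (by simp)
  let f : ModelProd (EuclideanSpace ℝ (Fin 1)) (ModelProd (EuclideanSpace ℝ (Fin 1))
      (EuclideanSpace ℝ (Fin 1))) ≃ₜ EuclideanSpace ℝ (Fin 3) := L.toHomeomorph
  have hIf : ∀ x, f x = L (((𝓡 1).prod ((𝓡 1).prod (𝓡 1))) x) := fun x => rfl
  have hf := Rechart.contMDiff_of_apply_eq_linear (I := (𝓡 1).prod ((𝓡 1).prod (𝓡 1))) (n := ∞)
    f L hIf
  have hf' := Rechart.contMDiff_symm_of_apply_eq_linear (I := (𝓡 1).prod ((𝓡 1).prod (𝓡 1)))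
    (n := ∞) f L hIf
  have hN : IsManifold (𝓡 3) ∞ (Rechart f (Circle × Circle × Circle)) := Rechart.isManifold f _ hf hf'
  haveI : SecondCountableTopology (Rechart f (Circle × Circle × Circle)) :=
    inferInstanceAs (SecondCountableTopology (Circle × Circle × Circle))
  haveI : ConnectedSpace (Rechart f (Circle × Circle × Circle)) :=
    inferInstanceAs (ConnectedSpace (Circle × Circle × Circle))
  obtain ⟨X, _, _, _, _, _, _, _, ⟨eX⟩, hσ⟩ := exists_prodCircle_model (Rechart f (Circle × Circle × Circle))
  exact ⟨X, inferInstance, inferInstance, inferInstance, inferInstance, inferInstance, inferInstance,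
    inferInstance, ⟨eX.trans ((Rechart.outHomeomorph f _).prodCongr (Homeomorph.refl Circle))⟩, hσ⟩

end Models

/-! ### `σ(N × S¹ # ℂℙ²bar) = -1`, `σ(T⁴ # ℂℙ²bar) = -1` -/

section BlowUp

/-- **`σ((N³ × S¹) # ℂℙ²bar) = -1`.** For a closed connected smooth `3`-manifold `N` (in `Type`)
there is a closed connected smooth `4`-manifold `X ≃ₜ N × S¹` (as in `exists_prodCircle_model`)
such that for EVERY `ℤ`-orientation `μ` of `X`: `σ(X, μ) = 0`, and there is a closed connected
smooth `4`-manifold `P` with `IsConnectedSum X ℂℙ² P` and an orientation of signature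
`σ(X, μ) - 1 = -1`, `b₂(P) = b₂(X) + 1` (blow-up bookkeeping
`exists_isConnectedSum_complexProjectivePlane_signature_sub_one`: connected-sum additivity of `σ`,
`b₂`, with `σ(ℂℙ²bar) = -1`; Gompf–Stipsicz 1999 §1.2, §2.2). This is Akhmedov–Park's
`σ(T⁴ # ℂℙ²bar) = 0 + (-1)` (§4) for a general `N³ × S¹` in place of `T⁴`; the orientation is an
INPUT `μ`. [cite: AkhmedovPark2010, §4 ("e(Z') = 1 and σ(Z') = -1")] [cite: GompfStipsiczGSM1999, §1.2] -/
theorem exists_isConnectedSum_prodCircle_complexProjectivePlane (N : Type) [TopologicalSpace N]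
    [T2Space N] [SecondCountableTopology N] [CompactSpace N] [ConnectedSpace N]
    [ChartedSpace (EuclideanSpace ℝ (Fin 3)) N] [IsManifold (𝓡 3) ∞ N] :
    ∃ (X : Type) (_ : TopologicalSpace X) (_ : T2Space X) (_ : SecondCountableTopology X)
      (_ : ChartedSpace (EuclideanSpace ℝ (Fin 4)) X) (_ : IsManifold (𝓡 4) ∞ X)
      (_ : CompactSpace X) (_ : ConnectedSpace X),
      Nonempty (X ≃ₜ N × Circle) ∧ ∀ μ : HomologicalOrientation ℤ X 4, μ.signature = 0 ∧
        ∃ (P : Type) (_ : TopologicalSpace P) (_ : T2Space P) (_ : SecondCountableTopology P)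
          (_ : ChartedSpace (EuclideanSpace ℝ (Fin 4)) P) (_ : IsManifold (𝓡 4) ∞ P)
          (_ : CompactSpace P) (_ : ConnectedSpace P) (μP : HomologicalOrientation ℤ P 4),
          IsConnectedSum (𝓡 4) (𝓡 4) (𝓡 4) X ComplexProjectivePlane P ∧ μP.signature = -1 ∧
            Module.finrank ℤ (freeCohomology ℤ P 2) = Module.finrank ℤ (freeCohomology ℤ X 2) + 1 := by
  obtain ⟨X, _, _, _, _, _, _, _, hXe, hσ⟩ := exists_prodCircle_model N
  refine ⟨X, inferInstance, inferInstance, inferInstance, inferInstance, inferInstance, inferInstance,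
    inferInstance, hXe, fun μ => ⟨hσ μ, ?_⟩⟩
  obtain ⟨P, _, _, _, _, _, _, _, μP, hsum, hσP, hb⟩ :=
    exists_isConnectedSum_complexProjectivePlane_signature_sub_one X μ
  exact ⟨P, inferInstance, inferInstance, inferInstance, inferInstance, inferInstance, inferInstance,
    inferInstance, μP, hsum, by rw [hσP, hσ μ]; norm_num, hb⟩

/-- **`σ(T⁴ # ℂℙ²bar) = -1`** (Akhmedov–Park 2010, §4: "`e(Z') = e(Z''(1/q, m/r)) = 1` and
`σ(Z') = σ(Z''(1/q, m/r)) = -1`", `Z''` being obtained from `T⁴ # ℂℙ²bar` by torus surgeries,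
which preserve `σ` — that invariance is NOT formalised here): for the `4`-torus `X ≃ₜ (S¹)⁴` of
`exists_fourTorus_model` and EVERY `ℤ`-orientation `μ` of it, `σ(X, μ) = 0` and there is a
connected sum `P` of `X` with `ℂℙ²` (oppositely oriented) with `σ(P) = -1`, `b₂(P) = b₂(X) + 1`.
The orientation of `T⁴` is an INPUT `μ`. [cite: AkhmedovPark2010, §4 ("σ(Z') = σ(Z'') = -1")] [cite: GompfStipsiczGSM1999, §1.2] -/
theorem exists_isConnectedSum_fourTorus_complexProjectivePlane :
    ∃ (X : Type) (_ : TopologicalSpace X) (_ : T2Space X) (_ : SecondCountableTopology X)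
      (_ : ChartedSpace (EuclideanSpace ℝ (Fin 4)) X) (_ : IsManifold (𝓡 4) ∞ X)
      (_ : CompactSpace X) (_ : ConnectedSpace X),
      Nonempty (X ≃ₜ (Circle × Circle × Circle) × Circle) ∧
        ∀ μ : HomologicalOrientation ℤ X 4, μ.signature = 0 ∧
          ∃ (P : Type) (_ : TopologicalSpace P) (_ : T2Space P) (_ : SecondCountableTopology P)
            (_ : ChartedSpace (EuclideanSpace ℝ (Fin 4)) P) (_ : IsManifold (𝓡 4) ∞ P)
            (_ : CompactSpace P) (_ : ConnectedSpace P) (μP : HomologicalOrientation ℤ P 4),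
            IsConnectedSum (𝓡 4) (𝓡 4) (𝓡 4) X ComplexProjectivePlane P ∧ μP.signature = -1 ∧
              Module.finrank ℤ (freeCohomology ℤ P 2) =
                Module.finrank ℤ (freeCohomology ℤ X 2) + 1 := by
  obtain ⟨X, _, _, _, _, _, _, _, hXe, hσ⟩ := exists_fourTorus_model
  refine ⟨X, inferInstance, inferInstance, inferInstance, inferInstance, inferInstance, inferInstance,
    inferInstance, hXe, fun μ => ⟨hσ μ, ?_⟩⟩
  obtain ⟨P, _, _, _, _, _, _, _, μP, hsum, hσP, hb⟩ :=
    exists_isConnectedSum_complexProjectivePlane_signature_sub_one X μ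
  exact ⟨P, inferInstance, inferInstance, inferInstance, inferInstance, inferInstance, inferInstance,
    inferInstance, μP, hsum, by rw [hσP, hσ μ]; norm_num, hb⟩

end BlowUp

end Literature.Topology.FourManifolds

end
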